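import Literature.Analysis.FluidPDE.TwoAndAHalfDimensionalFlows
import Literature.Analysis.FluidPDE.PlanarStretchingVanishes
import Literature.Analysis.FluidPDE.RadialEddies
import Literature.Analysis.FluidPDE.BiotSavart2DRadialEvaluation
import Literature.Analysis.FluidPDE.ClassicalSolutionGlue
import Literature.Analysis.FunctionSpaces.GaussianSchwartz
import Literature.Analysis.Calculus.IteratedFDerivLeibnizRecursion
import HarnessLib

/-!
# The planar Lamb–Oseen (Oseen) vortex as a classical planar Navier–Stokes run with
# Biot–Savart velocity and uniformly Schwartz vorticity (Gallay–Wayne 2005, §1; Majda–Bertozzi Ex. 2.2)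

Analysis/FluidPDE file, everything PROVED (three definitions with bodies — the planar velocity,
pressure and vorticity of the Oseen vortex — and theorems; no named fact).

PRINTED (Th. Gallay, C. E. Wayne, *Global stability of vortex solutions of the two-dimensional
Navier–Stokes equation*, Comm. Math. Phys. 255 (2005), §1, the display preceding Theorem 1.2, held
text arXiv:math/0402449 p. 3): "if `ω(x, t)` is a solution of (V) such that `∫ω(x, t)dx ≠ 0`, then the
velocity field `u(x, t)` given by (BS) [the Biot–Savart law] satisfies `|u(·, t)|₂ = ∞` for all `t`.
Explicit examples of such infinite energy solutions are the so-called Oseen vortices: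
`ω(x, t) = (α/4πt) e^{−|x|²/(4t)}`, `u(x, t) = (α/2π)(x^⊥/|x|²)(1 − e^{−|x|²/(4t)})`, where
`|x|² = x₁² + x₂²` and `α ∈ ℝ` is a parameter which is often referred to as the 'circulation Reynolds
number'. These solutions are 'trivial' in the sense that `u(x, t)·∇ω(x, t) ≡ 0`, so that (V) reduces
to the linear heat equation." Majda–Bertozzi (*Vorticity and Incompressible Flow*, CUP 2002, §2.2.1
Example 2.2, PDF p. 46) is the same statement for a general radial vorticity carried by the heat
equation; §2.3.1 Prop. 2.7 (PDF pp. 48–49) is the passage planar ↔ columnar three-dimensional flows.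

The tree already holds the Oseen vortex as a COLUMNAR flow on `ℝ³`
(`RadialEddy.isClassicalNSSolutionOn_lambOseen`, `RadialEddy.curl_lambOseen`, `RadialEddies.lean`),
the Biot–Savart velocity of a planar Gaussian (`biotSavart2D_gaussian_eq`,
`BiotSavart2DRadialEvaluation.lean`) and the forward half of MB Prop. 2.7
(`TwoAndAHalfD.isClassicalNSSolutionOn_planarLift`). This file supplies the PLANAR object that the
planar-vorticity library (`PlanarVorticityMoments`, `PlanarVorticityMaxPrinciple`,
`PlanarVorticityEntropy{,Nonneg,Velocity}`, `PlanarVelocityDecay`, `LundgrenStrainedPlanarFlows`, …)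
quantifies over — a classical planar run `ṽ` with `ṽ = K₂ ∗ ω̃` and uniformly rapidly decaying
vorticity — i.e. an explicit inhabitant of that hypothesis package:

* §1 `isClassicalNSSolutionOn_of_planarLift`, `isClassicalNSSolutionOn_planarLift_iff` — the
  converse half of MB Prop. 2.7 with `v³ ≡ 0`: a columnar field `(ṽ(t, x₀, x₁), 0)` with pressure
  `p̃(t, x₀, x₁)` is a classical 3D Navier–Stokes solution IFF `(ṽ, p̃)` is a classical planar one;
* §2 `planarLift_smul_perp` — the planar swirling field `q(t, |η|²) η^⊥` lifts to the tree's columnar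
  eddy `RadialEddy.eddy q` (`q(t, ρ) Jx`), and its pressure to `RadialEddy.eddyPressure`;
* §3′ (private plumbing, `hasUniformRapidDecayOn_mul_exp_neg_mul_norm_sq`) — `(σ, η) ↦ c(σ) e^{−r(σ)|η|²}`
  is uniformly Schwartz on `S × E` (the tree's `HasUniformRapidDecayOn S`) whenever `c, r` are smooth
  on the compact time set `S` and `r ≥ r₀ > 0` there (Faà di Bruno within the slab — Mathlib's
  `norm_iteratedFDerivWithin_comp_le` for `e^{−J}`, `J = r(σ)|η|²` — Leibniz for the amplitude,
  and the Gaussian absorption `Literature.Analysis.FunctionSpaces.max_pow_mul_exp_neg_mul_sq_le`;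
  kept private as an uncited folklore estimate — promote with a cite if needed elsewhere);
* §3 (namespace `PlanarLambOseen`) the planar Oseen vortex `velocity α ν t η = q(t, |η|²) η^⊥` with
  `q = RadialEddy.lambOseenProfile α ν` (`= (α/2π)(1 − e^{−|η|²/4νt})/|η|²` off the origin,
  `velocity_eq_of_ne_zero`), its pressure and its vorticity
  `vorticity α ν t η = (α/4πνt) e^{−|η|²/4νt}`: **`isClassicalNSSolutionOn_Ioi`** (a classical planar
  Navier–Stokes solution on `ℝ² × (0, ∞)` for every `α` and `ν > 0`), `planarVorticity_velocity`
  (`∂₁ṽ₂ − ∂₂ṽ₁ = ω` at every `t`, `ν ≠ 0`), **`velocity_eq_biotSavart2D`** (`ṽ = K₂ ∗ ω`,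
  Gallay–Wayne's "given by (BS)"), `integral_vorticity` (`∫ω = α`), `vorticity_pos`/`_nonneg`;
* §4 the run STARTED AT HEAT AGE `a`, `σ ↦ velocity α ν (σ + a)`: a classical solution on
  `(−a, ∞)`, on `[0, ∞)` and on `[0, T]` for `a > 0` (`isClassicalNSSolutionOn_shift{,_Ici,_Icc}`),
  initial vorticity the heat Gaussian `(α/4πνa) e^{−|η|²/4νa}` (`vorticity_shift_zero`, mass `α`,
  `≥ 0` for `α ≥ 0`), Biot–Savart representation on the slab (`velocity_shift_eq_biotSavart2D_Icc`),
  and **`hasUniformRapidDecayOn_planarVorticity_shift`**: its vorticity is uniformly Schwartz on every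
  compact slab `[0, T] × ℝ²` — so the shifted Oseen run inhabits, with all hypotheses discharged, the
  package «classical planar run on `[0, T]`, `ṽ = K₂ ∗ ω̃`, uniformly rapidly decaying vorticity,
  `ω̃(0) ≥ 0`, `∫ω̃(0) = α > 0`» of the planar-vorticity library.

NOT typed here: uniqueness of the run in any class; the self-similar variables of Gallay–Wayne §1;
finite-energy statements (the Oseen vortex has infinite energy, as printed). No named facts (D-0026).
HONEST FRAMING (cell `ns-blowup`, seat `ecbridge-8`): Literature infrastructure; nothing here is a claim
about three-dimensional Navier–Stokes regularity or blow-up.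

## References
* [GallayWayne2005] Th. Gallay, C. E. Wayne, Comm. Math. Phys. 255 (2005) 97–129, §1 (display before
  Thm. 1.2). doi:10.1007/s00220-004-1254-9, arXiv:math/0402449 p. 3.
* [MajdaBertozziCUP2002] A. J. Majda, A. L. Bertozzi, *Vorticity and Incompressible Flow*, CUP 2002,
  §2.2.1 Example 2.2 eqs. (2.15)–(2.16) (PDF p. 46); §2.3.1 Prop. 2.7 (PDF pp. 48–49).
-/

noncomputable section

open Set Function Filter MeasureTheory InnerProductSpace Real
open scoped RealInnerProductSpace ContDiff Laplacian Topology

namespace Literature.Analysis.FluidPDE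

/-! ### §1 The converse planar lift: columnar solutions with `v³ ≡ 0` are planar solutions -/

section PlanarLiftConverse

variable {S : Set ℝ} {ν : ℝ} {v : ℝ → EuclideanSpace ℝ (Fin 2) → EuclideanSpace ℝ (Fin 2)}
  {p : ℝ → EuclideanSpace ℝ (Fin 2) → ℝ}

/-- The gradient of a scalar depending on `(x₀, x₁)` only: `∇(q ∘ π)(x) = ι(∇q(πx))` (adjointness
`⟪ι a, w⟫ = ⟪a, π w⟫`; the computation of `TwoAndAHalfDimensionalFlows`). [folklore] -/
private theorem gradient_comp_projXY' {q : EuclideanSpace ℝ (Fin 2) → ℝ} {x : EuclideanSpace ℝ (Fin 3)}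
    (hq : DifferentiableAt ℝ q (projXY x)) :
    gradient (fun x : EuclideanSpace ℝ (Fin 3) => q (projXY x)) x = embedXY (gradient q (projXY x)) := by
  refine ext_inner_right ℝ fun w => ?_
  have hd : HasFDerivAt (fun x : EuclideanSpace ℝ (Fin 3) => q (projXY x))
      ((fderiv ℝ q (projXY x)).comp projXY) x :=
    hq.hasFDerivAt.comp x projXY.hasFDerivAt
  rw [gradient, hd.fderiv, InnerProductSpace.toDual_symm_apply, inner_embedXY_left, gradient,
    InnerProductSpace.toDual_symm_apply]
  rfl

/-- A planar field is jointly smooth on `S × ℝ²` as soon as its planar lift `(ṽ(t, x₀, x₁), 0)` is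
jointly smooth on `S × ℝ³` (read the lift on the plane `x₂ = 0` and project).
[cite: MajdaBertozziCUP2002, §2.3.1 Prop. 2.7] -/
theorem isSmoothSpaceTimeOn_of_planarLift (h : IsSmoothSpaceTimeOn S (planarLift v)) :
    IsSmoothSpaceTimeOn S v := by
  have hΦ : ContDiff ℝ ∞
      (fun z : ℝ × EuclideanSpace ℝ (Fin 2) => ((z.1, embedXY z.2) : ℝ × EuclideanSpace ℝ (Fin 3))) :=
    contDiff_fst.prodMk (embedXY.contDiff.comp contDiff_snd)
  have hmaps : MapsTo
      (fun z : ℝ × EuclideanSpace ℝ (Fin 2) => ((z.1, embedXY z.2) : ℝ × EuclideanSpace ℝ (Fin 3)))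
      (S ×ˢ univ) (S ×ˢ univ) :=
    fun z hz => ⟨hz.1, mem_univ _⟩
  have h1 : ContDiffOn ℝ ∞
      (fun z : ℝ × EuclideanSpace ℝ (Fin 2) =>
        projXY (uncurry (planarLift v) ((z.1, embedXY z.2) : ℝ × EuclideanSpace ℝ (Fin 3))))
      (S ×ˢ univ) :=
    projXY.contDiff.comp_contDiffOn (h.comp hΦ.contDiffOn hmaps)
  have heq : (fun z : ℝ × EuclideanSpace ℝ (Fin 2) =>
      projXY (uncurry (planarLift v) ((z.1, embedXY z.2) : ℝ × EuclideanSpace ℝ (Fin 3)))) =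
      uncurry v := by
    funext ⟨t, y⟩; simp
  have h2 : ContDiffOn ℝ ∞ (uncurry v) (S ×ˢ univ) := heq ▸ h1
  exact h2

/-- A planar scalar is jointly smooth on `S × ℝ²` as soon as its columnar extension `p̃(t, x₀, x₁)`
is jointly smooth on `S × ℝ³`. [cite: MajdaBertozziCUP2002, §2.3.1 Prop. 2.7] -/
theorem isSmoothSpaceTimeOn_of_pressure (h : IsSmoothSpaceTimeOn S (TwoAndAHalfD.pressure p)) :
    IsSmoothSpaceTimeOn S p := by
  have hΦ : ContDiff ℝ ∞
      (fun z : ℝ × EuclideanSpace ℝ (Fin 2) => ((z.1, embedXY z.2) : ℝ × EuclideanSpace ℝ (Fin 3))) :=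
    contDiff_fst.prodMk (embedXY.contDiff.comp contDiff_snd)
  have hmaps : MapsTo
      (fun z : ℝ × EuclideanSpace ℝ (Fin 2) => ((z.1, embedXY z.2) : ℝ × EuclideanSpace ℝ (Fin 3)))
      (S ×ˢ univ) (S ×ˢ univ) :=
    fun z hz => ⟨hz.1, mem_univ _⟩
  have h1 : ContDiffOn ℝ ∞
      (fun z : ℝ × EuclideanSpace ℝ (Fin 2) =>
        uncurry (TwoAndAHalfD.pressure p) ((z.1, embedXY z.2) : ℝ × EuclideanSpace ℝ (Fin 3)))
      (S ×ˢ univ) :=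
    h.comp hΦ.contDiffOn hmaps
  have heq : (fun z : ℝ × EuclideanSpace ℝ (Fin 2) =>
      uncurry (TwoAndAHalfD.pressure p) ((z.1, embedXY z.2) : ℝ × EuclideanSpace ℝ (Fin 3))) =
      uncurry p := by
    funext ⟨t, y⟩; simp
  have h2 : ContDiffOn ℝ ∞ (uncurry p) (S ×ˢ univ) := heq ▸ h1
  exact h2

/-- **Majda–Bertozzi Prop. 2.7 with `v³ ≡ 0`, converse direction: columnar solutions are planar
solutions.** On a time set `S` of unique differentiability, if the planar lift `(ṽ(t, x₀, x₁), 0)`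
with the pressure `p̃(t, x₀, x₁)` is a classical (unforced) 3D Navier–Stokes solution, then `(ṽ, p̃)`
is a classical planar Navier–Stokes solution with the same viscosity (read the 3D equations on the
plane `x₂ = 0` and project horizontally: every term is the horizontal embedding of its planar
counterpart, by the static calculus of `TwoAndAHalfDimensionalFlows`).
[cite: MajdaBertozziCUP2002, §2.3.1 Prop. 2.7 eqs. (2.31)–(2.32)] -/
theorem isClassicalNSSolutionOn_of_planarLift (hS : UniqueDiffOn ℝ S)
    (h : IsClassicalNSSolutionOn S ν 0 (planarLift v) (TwoAndAHalfD.pressure p)) :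
    IsClassicalNSSolutionOn S ν 0 v p := by
  have hv : IsSmoothSpaceTimeOn S v := isSmoothSpaceTimeOn_of_planarLift h.smooth_velocity
  have hp : IsSmoothSpaceTimeOn S p := isSmoothSpaceTimeOn_of_pressure h.smooth_pressure
  set v₃ : ℝ → EuclideanSpace ℝ (Fin 2) → ℝ := fun _ _ => 0 with hv₃
  have h₃ : IsSmoothSpaceTimeOn S v₃ := contDiffOn_const
  have eV0 : planarLift v = TwoAndAHalfD.velocity v v₃ := (TwoAndAHalfD.velocity_zero v).symm
  have eV : ∀ t, TwoAndAHalfD.velocity v v₃ t =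
      fun x : EuclideanSpace ℝ (Fin 3) => embedXY (v t (projXY x)) + v₃ t (projXY x) • eZ :=
    fun t => rfl
  have eP : ∀ t, TwoAndAHalfD.pressure p t = fun x : EuclideanSpace ℝ (Fin 3) => p t (projXY x) :=
    fun t => rfl
  refine ⟨hv, hp, fun t ht y => ?_, fun t ht y => ?_⟩
  · have hvs : ContDiff ℝ ∞ (v t) := hv.contDiff_slice ht
    have h3s : ContDiff ℝ ∞ (v₃ t) := h₃.contDiff_slice ht
    have hps : ContDiff ℝ ∞ (p t) := hp.contDiff_slice ht
    have hva : DifferentiableAt ℝ (v t) (projXY (embedXY y)) :=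
      (hvs.differentiable (by simp)).differentiableAt
    have h3a : DifferentiableAt ℝ (v₃ t) (projXY (embedXY y)) :=
      (h3s.differentiable (by simp)).differentiableAt
    have hpa : DifferentiableAt ℝ (p t) (projXY (embedXY y)) :=
      (hps.differentiable (by simp)).differentiableAt
    have hm := h.momentum t ht (embedXY y)
    rw [eV0, TwoAndAHalfD.timeDerivWithin_velocity hS hv h₃ ht (embedXY y), eV t,
      TwoAndAHalfD.convect_slice hva h3a,
      TwoAndAHalfD.laplacian_slice (hvs.of_le (by norm_cast)) (h3s.of_le (by norm_cast)),
      eP t, gradient_comp_projXY' hpa] at hm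
    have h2 := congrArg projXY hm
    simp only [map_add, map_sub, map_smul, projXY_embedXY, projXY_eZ, smul_zero, add_zero,
      Pi.zero_apply] at h2
    simpa using h2
  · have hvs : ContDiff ℝ ∞ (v t) := hv.contDiff_slice ht
    have h3s : ContDiff ℝ ∞ (v₃ t) := h₃.contDiff_slice ht
    have hva : DifferentiableAt ℝ (v t) (projXY (embedXY y)) :=
      (hvs.differentiable (by simp)).differentiableAt
    have h3a : DifferentiableAt ℝ (v₃ t) (projXY (embedXY y)) :=
      (h3s.differentiable (by simp)).differentiableAt
    have hd := h.divFree t ht (embedXY y)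
    rw [eV0, eV t, TwoAndAHalfD.divergence_slice hva h3a, projXY_embedXY] at hd
    exact hd

/-- **MB Prop. 2.7 with `v³ ≡ 0` as an equivalence**: on a time set of unique differentiability,
`(ṽ(t, x₀, x₁), 0)` with pressure `p̃(t, x₀, x₁)` is a classical 3D Navier–Stokes solution iff
`(ṽ, p̃)` is a classical planar one. [cite: MajdaBertozziCUP2002, §2.3.1 Prop. 2.7 eqs. (2.31)–(2.32)] -/
theorem isClassicalNSSolutionOn_planarLift_iff (hS : UniqueDiffOn ℝ S) :
    IsClassicalNSSolutionOn S ν 0 (planarLift v) (TwoAndAHalfD.pressure p) ↔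
      IsClassicalNSSolutionOn S ν 0 v p :=
  ⟨isClassicalNSSolutionOn_of_planarLift hS, TwoAndAHalfD.isClassicalNSSolutionOn_planarLift hS⟩

end PlanarLiftConverse

/-! ### §2 Planar swirling fields `q(t, |η|²) η^⊥` lift to the columnar eddies `q(t, ρ) Jx` -/

section PlanarEddy

/-- `|π x|² = ρ(x) = x₀² + x₁²`. [folklore] -/
private theorem norm_sq_projXY (x : EuclideanSpace ℝ (Fin 3)) :
    ‖projXY x‖ ^ 2 = StrainedAzimuthal.rho x := by
  rw [EuclideanSpace.norm_sq_eq, Fin.sum_univ_two, StrainedAzimuthal.rho_apply]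
  simp [sq_abs]

/-- `|ι η|`-squared horizontal radius: `ρ(ι η) = |η|²`. [folklore] -/
private theorem rho_embedXY (η : EuclideanSpace ℝ (Fin 2)) :
    StrainedAzimuthal.rho (embedXY η) = ‖η‖ ^ 2 := by
  rw [← norm_sq_projXY, projXY_embedXY]

/-- **The planar swirling field lifts to the columnar eddy**: for every profile `q(t, σ)`,
the planar lift of `ṽ(t, η) = q(t, |η|²) η^⊥` is the tree's `RadialEddy.eddy q`
(`v(t, x) = q(t, ρ(x)) Jx`, `Jx = (−x₁, x₀, 0)`) — MB's (2.16) read in the plane and in space.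
[cite: MajdaBertozziCUP2002, §2.2.1 Example 2.2 eq. (2.16)] -/
theorem planarLift_smul_perp (q : ℝ → ℝ → ℝ) :
    planarLift (fun t (η : EuclideanSpace ℝ (Fin 2)) => q t (‖η‖ ^ 2) • perp η) = RadialEddy.eddy q := by
  funext t x
  have hn := norm_sq_projXY x
  ext i
  fin_cases i <;>
    simp [RadialEddy.eddy, StrainedAzimuthal.azimuthal, hn, perp, rotGen, map_smul]

/-- The columnar extension of the planar pressure `P(t, |η|²)` is the tree's
`RadialEddy.eddyPressure P` (`p(t, x) = P(t, ρ(x))`). [cite: MajdaBertozziCUP2002, §2.2.1 Example 2.2 eq. (2.16)] -/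
theorem pressure_norm_sq (P : ℝ → ℝ → ℝ) :
    TwoAndAHalfD.pressure (fun t (η : EuclideanSpace ℝ (Fin 2)) => P t (‖η‖ ^ 2)) =
      RadialEddy.eddyPressure P := by
  funext t x
  simp [TwoAndAHalfD.pressure, RadialEddy.eddyPressure, norm_sq_projXY]

end PlanarEddy

/-! ### §3′ Uniform Schwartz decay of `c(σ) e^{−r(σ)|η|²}` on compact time sets -/

section Decay

variable {E : Type*} [NormedAddCommGroup E] [InnerProductSpace ℝ E]

/-- A time factor read on the slab: `‖Dⁱ_{S×E} (φ ∘ fst)(z)‖ ≤ ‖Dⁱ_S φ(z.1)‖` (composition with the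
projection `fst`, of operator norm `≤ 1`). [folklore] -/
private theorem norm_iteratedFDerivWithin_comp_fst_le {S : Set ℝ} (hS : UniqueDiffOn ℝ S)
    {φ : ℝ → ℝ} (hφ : ContDiffOn ℝ ∞ φ S) (i : ℕ) {z : ℝ × E} (hz : z ∈ S ×ˢ (univ : Set E)) :
    ‖iteratedFDerivWithin ℝ i (fun z : ℝ × E => φ z.1) (S ×ˢ univ) z‖ ≤
      ‖iteratedFDerivWithin ℝ i φ S z.1‖ := by
  have hpre : (⇑(ContinuousLinearMap.fst ℝ ℝ E)) ⁻¹' S = S ×ˢ (univ : Set E) := by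
    ext w; simp
  have hUD : UniqueDiffOn ℝ ((⇑(ContinuousLinearMap.fst ℝ ℝ E)) ⁻¹' S) := by
    rw [hpre]; exact hS.prod uniqueDiffOn_univ
  have hz1 : (ContinuousLinearMap.fst ℝ ℝ E) z ∈ S := (mem_prod.1 hz).1
  have key := (ContinuousLinearMap.fst ℝ ℝ E).iteratedFDerivWithin_comp_right hφ hS hUD hz1
    (i := i) (by exact_mod_cast le_top)
  rw [hpre] at key
  rw [show (fun z : ℝ × E => φ z.1) = φ ∘ ⇑(ContinuousLinearMap.fst ℝ ℝ E) from rfl, key]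
  refine (ContinuousMultilinearMap.norm_compContinuousLinearMap_le _ _).trans ?_
  have h1 : ∏ _i : Fin i, ‖ContinuousLinearMap.fst ℝ ℝ E‖ ≤ 1 :=
    Finset.prod_le_one (fun _ _ => norm_nonneg (ContinuousLinearMap.fst ℝ ℝ E)) fun _ _ =>
      ContinuousLinearMap.norm_fst_le ℝ ℝ E
  calc ‖iteratedFDerivWithin ℝ i φ S ((ContinuousLinearMap.fst ℝ ℝ E) z)‖ *
        ∏ _i : Fin i, ‖ContinuousLinearMap.fst ℝ ℝ E‖
      ≤ ‖iteratedFDerivWithin ℝ i φ S z.1‖ * 1 := mul_le_mul_of_nonneg_left h1 (norm_nonneg _)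
    _ = ‖iteratedFDerivWithin ℝ i φ S z.1‖ := mul_one _

/-- The space factor `|η|²` read on the slab: `‖Dⁱ_{S×E} (|·|² ∘ snd)(z)‖ ≤ ‖Dⁱ |·|² (z.2)‖`.
[folklore] -/
private theorem norm_iteratedFDerivWithin_norm_sq_snd_le {S : Set ℝ} (hS : UniqueDiffOn ℝ S)
    (i : ℕ) {z : ℝ × E} (hz : z ∈ S ×ˢ (univ : Set E)) :
    ‖iteratedFDerivWithin ℝ i (fun z : ℝ × E => ‖z.2‖ ^ 2) (S ×ˢ univ) z‖ ≤
      ‖iteratedFDeriv ℝ i (fun x : E => ‖x‖ ^ 2) z.2‖ := by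
  have hsm : ContDiff ℝ ∞ (fun x : E => ‖x‖ ^ 2) := contDiff_norm_sq ℝ
  have hsm2 : ContDiff ℝ ∞ (fun z : ℝ × E => ‖z.2‖ ^ 2) := hsm.comp contDiff_snd
  rw [iteratedFDerivWithin_eq_iteratedFDeriv (hS.prod uniqueDiffOn_univ)
    (hsm2.contDiffAt.of_le (by exact_mod_cast le_top)) hz,
    show (fun z : ℝ × E => ‖z.2‖ ^ 2) = (fun x : E => ‖x‖ ^ 2) ∘ ⇑(ContinuousLinearMap.snd ℝ ℝ E)
      from rfl,
    (ContinuousLinearMap.snd ℝ ℝ E).iteratedFDeriv_comp_right hsm z (i := i) (by exact_mod_cast le_top)]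
  refine (ContinuousMultilinearMap.norm_compContinuousLinearMap_le _ _).trans ?_
  have h1 : ∏ _i : Fin i, ‖ContinuousLinearMap.snd ℝ ℝ E‖ ≤ 1 :=
    Finset.prod_le_one (fun _ _ => norm_nonneg (ContinuousLinearMap.snd ℝ ℝ E)) fun _ _ =>
      ContinuousLinearMap.norm_snd_le ℝ ℝ E
  calc ‖iteratedFDeriv ℝ i (fun x : E => ‖x‖ ^ 2) ((ContinuousLinearMap.snd ℝ ℝ E) z)‖ *
        ∏ _i : Fin i, ‖ContinuousLinearMap.snd ℝ ℝ E‖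
      ≤ ‖iteratedFDeriv ℝ i (fun x : E => ‖x‖ ^ 2) z.2‖ * 1 :=
        mul_le_mul_of_nonneg_left h1 (norm_nonneg _)
    _ = ‖iteratedFDeriv ℝ i (fun x : E => ‖x‖ ^ 2) z.2‖ := mul_one _

/-- All derivatives of `|·|²` at `η` are bounded by `W^{n+2}`, `W = 2·max(|η|, 1)`, for orders `≤ n`
(`|η|²` at order `0`, `(max (2|η|) 2)^i` at order `i ≥ 1`, the tree's
`Literature.Analysis.FunctionSpaces.norm_iteratedFDeriv_norm_sq_le`). [folklore] -/
private theorem norm_iteratedFDeriv_norm_sq_le_pow (η : E) {i n : ℕ} (hi : i ≤ n) :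
    ‖iteratedFDeriv ℝ i (fun x : E => ‖x‖ ^ 2) η‖ ≤ (2 * max ‖η‖ 1) ^ (n + 2) := by
  have hW1 : (1 : ℝ) ≤ 2 * max ‖η‖ 1 := by
    have := le_max_right ‖η‖ 1; linarith
  rcases Nat.eq_zero_or_pos i with h0 | hpos
  · subst h0
    rw [norm_iteratedFDeriv_zero, Real.norm_of_nonneg (by positivity)]
    calc ‖η‖ ^ 2 ≤ (max ‖η‖ 1) ^ 2 := pow_le_pow_left₀ (norm_nonneg _) (le_max_left _ _) 2
      _ ≤ (2 * max ‖η‖ 1) ^ 2 :=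
          pow_le_pow_left₀ (by positivity) (by linarith [le_max_right ‖η‖ 1]) 2
      _ ≤ (2 * max ‖η‖ 1) ^ (n + 2) := pow_le_pow_right₀ hW1 (by omega)
  · have h := Literature.Analysis.FunctionSpaces.norm_iteratedFDeriv_norm_sq_le η (i := i) hpos
    have hmax : max (2 * ‖η‖) 2 = 2 * max ‖η‖ 1 := by
      rw [mul_max_of_nonneg _ _ (by norm_num : (0 : ℝ) ≤ 2), mul_one]
    rw [hmax] at h
    exact h.trans (pow_le_pow_right₀ hW1 (by omega))

open Literature.Analysis.Calculus in
/-- **Uniform Schwartz decay of a Gaussian with time-dependent amplitude and width.** Let `S ⊆ ℝ`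
be a compact time set of unique differentiability (e.g. `[0, T]`, `T > 0`), `c, r : ℝ → ℝ` smooth
on `S`, and `r ≥ r₀ > 0` on `S`. Then the space–time field `w(σ, η) = c(σ) e^{−r(σ)|η|²}` on
`S × E` has the tree's uniform rapid decay `HasUniformRapidDecayOn S w`: every weighted joint
derivative `(1 + |η|)^K ‖Dⁿ_{S×E} w(σ, η)‖` is bounded on the slab. Proof: Faà di Bruno within the
slab for `e^{−J}`, `J(σ, η) = r(σ)|η|²` (Mathlib's `norm_iteratedFDerivWithin_comp_le`, with
`‖Dⁱe^{−s}‖ = e^{−s}` and `‖DⁱJ‖ ≤ 2ⁿ A W^{n+2}`, `W = 2 max(|η|, 1)`, `A` a bound for the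
derivatives of `c, r` on the compact `S`), Leibniz for the amplitude, and the absorption
`(max(|η|,1))^M e^{−r₀|η|²} ≤ 1 + M!/r₀^M`. [folklore] -/
private theorem hasUniformRapidDecayOn_mul_exp_neg_mul_norm_sq {S : Set ℝ} (hSc : IsCompact S)
    (hS : UniqueDiffOn ℝ S) {c r : ℝ → ℝ} (hc : ContDiffOn ℝ ∞ c S) (hr : ContDiffOn ℝ ∞ r S)
    {r₀ : ℝ} (hr₀ : 0 < r₀) (hrr : ∀ σ ∈ S, r₀ ≤ r σ) :
    HasUniformRapidDecayOn S (fun σ (η : E) => c σ * Real.exp (-(r σ * ‖η‖ ^ 2))) := by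
  intro n K
  have hUD : UniqueDiffOn ℝ (S ×ˢ (univ : Set E)) := hS.prod uniqueDiffOn_univ
  -- (1) uniform bounds for the time factors on the compact `S`
  have hbd : ∀ φ : ℝ → ℝ, ContDiffOn ℝ ∞ φ S → ∀ i : ℕ, ∃ M : ℝ, ∀ σ ∈ S,
      ‖iteratedFDerivWithin ℝ i φ S σ‖ ≤ M := by
    intro φ hφ i
    exact hSc.exists_bound_of_continuousOn
      (hφ.continuousOn_iteratedFDerivWithin (by exact_mod_cast le_top) hS)
  choose Mc hMc using hbd c hc
  choose Mr hMr using hbd r hr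
  set A : ℝ := 1 + ∑ i ∈ Finset.range (n + 1), (|Mc i| + |Mr i|) with hA
  have hsum0 : 0 ≤ ∑ i ∈ Finset.range (n + 1), (|Mc i| + |Mr i|) :=
    Finset.sum_nonneg fun i _ => by positivity
  have hA1 : 1 ≤ A := by rw [hA]; linarith
  have hA0 : 0 ≤ A := zero_le_one.trans hA1
  have hsingle : ∀ i ≤ n, |Mc i| + |Mr i| ≤ ∑ j ∈ Finset.range (n + 1), (|Mc j| + |Mr j|) :=
    fun i hi => Finset.single_le_sum (f := fun j => |Mc j| + |Mr j|) (fun j _ => by positivity)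
      (Finset.mem_range.2 (Nat.lt_succ_of_le hi))
  have hAc : ∀ i ≤ n, ∀ z ∈ S ×ˢ (univ : Set E),
      ‖iteratedFDerivWithin ℝ i (fun z : ℝ × E => c z.1) (S ×ˢ univ) z‖ ≤ A := by
    intro i hi z hz
    refine (norm_iteratedFDerivWithin_comp_fst_le hS hc i hz).trans ?_
    have h1 := hMc i z.1 (mem_prod.1 hz).1
    have h2 := hsingle i hi
    rw [hA]; linarith [le_abs_self (Mc i), abs_nonneg (Mr i)]
  have hAr : ∀ i ≤ n, ∀ z ∈ S ×ˢ (univ : Set E),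
      ‖iteratedFDerivWithin ℝ i (fun z : ℝ × E => r z.1) (S ×ˢ univ) z‖ ≤ A := by
    intro i hi z hz
    refine (norm_iteratedFDerivWithin_comp_fst_le hS hr i hz).trans ?_
    have h1 := hMr i z.1 (mem_prod.1 hz).1
    have h2 := hsingle i hi
    rw [hA]; linarith [le_abs_self (Mr i), abs_nonneg (Mc i)]
  -- smoothness of the pieces on the slab
  have hmaps1 : MapsTo (fun z : ℝ × E => z.1) (S ×ˢ (univ : Set E)) S := fun z hz => (mem_prod.1 hz).1
  have hcU : ContDiffOn ℝ ∞ (fun z : ℝ × E => c z.1) (S ×ˢ univ) := hc.comp contDiffOn_fst hmaps1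
  have hrU : ContDiffOn ℝ ∞ (fun z : ℝ × E => r z.1) (S ×ˢ univ) := hr.comp contDiffOn_fst hmaps1
  have hnU : ContDiffOn ℝ ∞ (fun z : ℝ × E => ‖z.2‖ ^ 2) (S ×ˢ univ) :=
    ((contDiff_norm_sq ℝ (E := E)).comp contDiff_snd).contDiffOn
  set J : ℝ × E → ℝ := fun z => r z.1 * ‖z.2‖ ^ 2 with hJ
  have hJU : ContDiffOn ℝ ∞ J (S ×ˢ univ) := hrU.mul hnU
  set g : ℝ → ℝ := fun s => Real.exp ((-1) * s) with hg
  have hgs : ContDiff ℝ ∞ g := by rw [hg]; fun_prop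
  have hgJU : ContDiffOn ℝ ∞ (g ∘ J) (S ×ˢ univ) := hgs.comp_contDiffOn hJU
  -- the constant
  set M : ℕ := K + (n + 2) * n with hM
  refine ⟨2 ^ n * A * n.factorial * (2 ^ n * A) ^ n * (2 ^ M * (1 + M.factorial / r₀ ^ M)),
    fun σ hσ η => ?_⟩
  have hz : ((σ, η) : ℝ × E) ∈ S ×ˢ (univ : Set E) := mk_mem_prod hσ (mem_univ _)
  -- the polynomial weight `W = 2 max(|η|, 1)`
  set W : ℝ := 2 * max ‖η‖ 1 with hW
  have hW1 : 1 ≤ W := by have := le_max_right ‖η‖ 1; rw [hW]; linarith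
  have hW0 : 0 ≤ W := zero_le_one.trans hW1
  -- (2) derivatives of `J` on the slab: `‖Dˡ J‖ ≤ 2ⁿ A W^{n+2} =: D`
  set D : ℝ := 2 ^ n * A * W ^ (n + 2) with hD
  have hD1 : 1 ≤ D := by
    rw [hD]
    have h2 : (1 : ℝ) ≤ 2 ^ n := one_le_pow₀ (by norm_num)
    calc (1 : ℝ) = 1 * 1 * 1 := by ring
      _ ≤ 2 ^ n * A * W ^ (n + 2) :=
          mul_le_mul (mul_le_mul h2 hA1 zero_le_one (by positivity)) (one_le_pow₀ hW1) zero_le_one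
            (by positivity)
  have hD0 : 0 ≤ D := zero_le_one.trans hD1
  have hJb : ∀ l ≤ n, ‖iteratedFDerivWithin ℝ l J (S ×ˢ univ) (σ, η)‖ ≤ D := by
    intro l hl
    have hle := norm_iteratedFDerivWithin_mul_le hrU hnU hUD hz (n := l) (by exact_mod_cast le_top)
    refine hle.trans ?_
    have hsum := sum_choose_mul_le (n := l)
      (x := fun j => ‖iteratedFDerivWithin ℝ j (fun z : ℝ × E => r z.1) (S ×ˢ univ) (σ, η)‖)
      (y := fun j => ‖iteratedFDerivWithin ℝ j (fun z : ℝ × E => ‖z.2‖ ^ 2) (S ×ˢ univ) (σ, η)‖)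
      (X := A) (Y := W ^ (n + 2)) (fun j _ => norm_nonneg _) (fun j hj => hAr j (hj.trans hl) _ hz)
      (fun j _ => norm_nonneg _)
      (fun j hj => (norm_iteratedFDerivWithin_norm_sq_snd_le hS j hz).trans
        (norm_iteratedFDeriv_norm_sq_le_pow η (hj.trans hl)))
    refine hsum.trans ?_
    rw [hD]
    have h2l : (2 : ℝ) ^ l ≤ 2 ^ n := pow_le_pow_right₀ one_le_two hl
    have : 0 ≤ A * W ^ (n + 2) := by positivity
    nlinarith
  -- (3) Faà di Bruno for `e^{−J}` within the slab: `‖Dᵐ e^{−J}‖ ≤ m! e^{−J} Dᵐ`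
  have hexp : ∀ m ≤ n, ‖iteratedFDerivWithin ℝ m (g ∘ J) (S ×ˢ univ) (σ, η)‖ ≤
      m.factorial * Real.exp (-J (σ, η)) * D ^ m := by
    intro m hm
    refine norm_iteratedFDerivWithin_comp_le (t := univ) hgs.contDiffOn hJU (by exact_mod_cast le_top)
      uniqueDiffOn_univ hUD (mapsTo_univ _ _) hz (fun i _ => ?_) (fun i hi him => ?_)
    · rw [iteratedFDerivWithin_univ, hg,
        Literature.Analysis.FunctionSpaces.norm_iteratedFDeriv_exp_const_mul (-1) i (J (σ, η))]
      simp
    · exact (hJb i (him.trans hm)).trans (le_self_pow₀ hD1 (by omega))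
  -- (4) Leibniz for the amplitude: `‖Dⁿ (c e^{−J})‖ ≤ 2ⁿ A n! e^{−J} Dⁿ`
  have hF : uncurry (fun σ (η : E) => c σ * Real.exp (-(r σ * ‖η‖ ^ 2))) =
      fun z : ℝ × E => (fun z : ℝ × E => c z.1) z * (g ∘ J) z := by
    funext z
    simp only [uncurry, comp_apply, hg, hJ, neg_one_mul]
  have hprod : ‖iteratedFDerivWithin ℝ n (uncurry fun σ (η : E) => c σ * Real.exp (-(r σ * ‖η‖ ^ 2)))
      (S ×ˢ univ) (σ, η)‖ ≤ 2 ^ n * A * (n.factorial * Real.exp (-J (σ, η)) * D ^ n) := by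
    rw [hF]
    have hle := norm_iteratedFDerivWithin_mul_le hcU hgJU hUD hz (n := n) (by exact_mod_cast le_top)
    refine hle.trans ?_
    refine sum_choose_mul_le (n := n)
      (x := fun j => ‖iteratedFDerivWithin ℝ j (fun z : ℝ × E => c z.1) (S ×ˢ univ) (σ, η)‖)
      (y := fun j => ‖iteratedFDerivWithin ℝ j (g ∘ J) (S ×ˢ univ) (σ, η)‖)
      (X := A) (Y := n.factorial * Real.exp (-J (σ, η)) * D ^ n) (fun j _ => norm_nonneg _)
      (fun j hj => hAc j hj _ hz) (fun j _ => norm_nonneg _) (fun j hj => (hexp j hj).trans ?_)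
    have hfac : (j.factorial : ℝ) ≤ n.factorial := by exact_mod_cast Nat.factorial_le hj
    have hpow : D ^ j ≤ D ^ n := pow_le_pow_right₀ hD1 hj
    have he : 0 ≤ Real.exp (-J (σ, η)) := (Real.exp_pos _).le
    exact mul_le_mul (mul_le_mul_of_nonneg_right hfac he) hpow (by positivity) (by positivity)
  -- (5) the Gaussian absorbs the polynomial weights
  have hweight : (1 + ‖η‖) ^ K ≤ W ^ K := by
    refine pow_le_pow_left₀ (by positivity) ?_ K
    rw [hW]
    rcases le_total ‖η‖ 1 with h | h
    · rw [max_eq_right h]; linarith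
    · rw [max_eq_left h]; linarith
  have hJge : r₀ * ‖η‖ ^ 2 ≤ J (σ, η) := by
    simp only [hJ]
    exact mul_le_mul_of_nonneg_right (hrr σ hσ) (sq_nonneg _)
  have hexple : Real.exp (-J (σ, η)) ≤ Real.exp (-r₀ * ‖η‖ ^ 2) := by
    rw [Real.exp_le_exp, neg_mul]; linarith
  have habs := Literature.Analysis.FunctionSpaces.max_pow_mul_exp_neg_mul_sq_le hr₀ M ‖η‖
  have hWM : W ^ K * D ^ n = (2 ^ n * A) ^ n * (2 ^ M * (max ‖η‖ 1) ^ M) := by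
    have h1 : D ^ n = (2 ^ n * A) ^ n * W ^ ((n + 2) * n) := by rw [hD, mul_pow, ← pow_mul]
    have h2 : (2 : ℝ) ^ M * (max ‖η‖ 1) ^ M = W ^ M := by rw [hW, mul_pow]
    rw [h1, h2, hM, pow_add]
    ring
  calc (1 + ‖η‖) ^ K * ‖iteratedFDerivWithin ℝ n
        (uncurry fun σ (η : E) => c σ * Real.exp (-(r σ * ‖η‖ ^ 2))) (S ×ˢ univ) (σ, η)‖
      ≤ W ^ K * (2 ^ n * A * (n.factorial * Real.exp (-J (σ, η)) * D ^ n)) :=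
        mul_le_mul hweight hprod (norm_nonneg _) (by positivity)
    _ = 2 ^ n * A * n.factorial * (W ^ K * D ^ n) * Real.exp (-J (σ, η)) := by ring
    _ = 2 ^ n * A * n.factorial * (2 ^ n * A) ^ n * 2 ^ M *
          ((max ‖η‖ 1) ^ M * Real.exp (-J (σ, η))) := by rw [hWM]; ring
    _ ≤ 2 ^ n * A * n.factorial * (2 ^ n * A) ^ n * 2 ^ M *
          ((max ‖η‖ 1) ^ M * Real.exp (-r₀ * ‖η‖ ^ 2)) := by
        gcongr
    _ ≤ 2 ^ n * A * n.factorial * (2 ^ n * A) ^ n * 2 ^ M * (1 + M.factorial / r₀ ^ M) := by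
        gcongr
    _ = 2 ^ n * A * n.factorial * (2 ^ n * A) ^ n * (2 ^ M * (1 + M.factorial / r₀ ^ M)) := by ring

end Decay

/-! ### §3 The planar Oseen vortex -/

namespace PlanarLambOseen

/-- **The planar Lamb–Oseen (Oseen vortex) velocity** with circulation parameter `α` at viscosity
`ν` and time `t`: `ṽ(t, η) = q(t, |η|²) η^⊥` with the tree's smooth swirl profile
`q = RadialEddy.lambOseenProfile α ν` (`q(t, σ) = (α/2π)(4νt)⁻¹A₀(σ/4νt)`), i.e. Gallay–Wayne's
`u(x, t) = (α/2π)(x^⊥/|x|²)(1 − e^{−|x|²/(4νt)})` off the origin (`velocity_eq_of_ne_zero`) with the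
removable singularity filled in. [cite: GallayWayne2005, §1 (the Oseen vortices, display preceding Thm. 1.2)] -/
def velocity (α ν t : ℝ) (η : EuclideanSpace ℝ (Fin 2)) : EuclideanSpace ℝ (Fin 2) :=
  RadialEddy.lambOseenProfile α ν t (‖η‖ ^ 2) • perp η

/-- **The planar Lamb–Oseen pressure** `p̃(t, η) = P(t, |η|²)`, `P = RadialEddy.lambOseenPressure α ν`
(`= ½∫₀^{|η|²} q(t, s)² ds`, cyclostrophic balance `∂ᵣp = v_θ²/r`).
[cite: MajdaBertozziCUP2002, §2.2.1 Example 2.2 eq. (2.16)] -/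
def pressure (α ν t : ℝ) (η : EuclideanSpace ℝ (Fin 2)) : ℝ :=
  RadialEddy.lambOseenPressure α ν t (‖η‖ ^ 2)

/-- **The planar Lamb–Oseen vorticity** `ω(x, t) = (α/4πνt) e^{−|x|²/(4νt)}` — `α` times the planar
heat kernel at time `νt`. [cite: GallayWayne2005, §1 (the Oseen vortices, display preceding Thm. 1.2)] -/
def vorticity (α ν t : ℝ) (η : EuclideanSpace ℝ (Fin 2)) : ℝ :=
  α / (4 * π * ν * t) * exp (-‖η‖ ^ 2 / (4 * ν * t))

variable {α ν t : ℝ}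

/-- The planar Oseen velocity lifts to the tree's columnar Oseen vortex `RadialEddy.eddy (lambOseenProfile α ν)`.
[cite: GallayWayne2005, §1 (the Oseen vortices, display preceding Thm. 1.2)] -/
theorem planarLift_velocity (α ν : ℝ) :
    planarLift (velocity α ν) = RadialEddy.eddy (RadialEddy.lambOseenProfile α ν) :=
  planarLift_smul_perp _

/-- The columnar extension of the planar Oseen pressure is the tree's `RadialEddy.eddyPressure (lambOseenPressure α ν)`.
[cite: MajdaBertozziCUP2002, §2.2.1 Example 2.2 eq. (2.16)] -/
theorem pressure_lift (α ν : ℝ) :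
    TwoAndAHalfD.pressure (pressure α ν) = RadialEddy.eddyPressure (RadialEddy.lambOseenPressure α ν) :=
  pressure_norm_sq _

/-- **Gallay–Wayne's formula off the origin**: for `ν, t ≠ 0` and `η ≠ 0`,
`ṽ(t, η) = (α/2π)((1 − e^{−|η|²/(4νt)})/|η|²) η^⊥`. [cite: GallayWayne2005, §1 (the Oseen vortices, display preceding Thm. 1.2)] -/
theorem velocity_eq_of_ne_zero (hν : ν ≠ 0) (ht : t ≠ 0) {η : EuclideanSpace ℝ (Fin 2)}
    (hη : η ≠ 0) :
    velocity α ν t η = (α / (2 * π) * ((1 - exp (-‖η‖ ^ 2 / (4 * ν * t))) / ‖η‖ ^ 2)) • perp η := by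
  have hn : ‖η‖ ^ 2 ≠ 0 := by positivity
  rw [velocity, RadialEddy.lambOseenProfile_eq hν ht hn]

/-- At the origin the planar Oseen velocity vanishes. [cite: GallayWayne2005, §1 (the Oseen vortices, display preceding Thm. 1.2)] -/
@[simp] theorem velocity_zero_right (α ν t : ℝ) : velocity α ν t 0 = 0 := by
  simp [velocity]

/-- **The planar Oseen vortex is a classical planar Navier–Stokes solution on `ℝ² × (0, ∞)`** for
every `α` and every `ν > 0` (the tree's columnar theorem `RadialEddy.isClassicalNSSolutionOn_lambOseen`
read back in the plane through §1). [cite: GallayWayne2005, §1 (the Oseen vortices, display preceding Thm. 1.2)] -/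
theorem isClassicalNSSolutionOn_Ioi (α : ℝ) (hν : 0 < ν) :
    IsClassicalNSSolutionOn (Ioi 0) ν 0 (velocity α ν) (pressure α ν) := by
  refine isClassicalNSSolutionOn_of_planarLift (uniqueDiffOn_Ioi 0) ?_
  rw [planarLift_velocity, pressure_lift]
  exact RadialEddy.isClassicalNSSolutionOn_lambOseen α hν

/-- At time `t = 0` the (junk-valued) planar Oseen velocity is the zero field (`(4ν·0)⁻¹ = 0`).
[folklore] -/
private theorem velocity_time_zero (α ν : ℝ) : velocity α ν 0 = fun _ => 0 := by
  funext η
  simp [velocity, RadialEddy.lambOseenProfile]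

/-- **The scalar vorticity of the planar Oseen vortex is the Gaussian**
`∂₁ṽ₂ − ∂₂ṽ₁ = (α/4πνt) e^{−|η|²/(4νt)}` (`ν ≠ 0`; the tree's `RadialEddy.curl_lambOseen` on the
plane `x₂ = 0` for `t ≠ 0`; at the junk time `t = 0` both sides vanish).
[cite: GallayWayne2005, §1 (the Oseen vortices, display preceding Thm. 1.2)] -/
theorem planarVorticity_velocity (hν : ν ≠ 0) (t : ℝ) (η : EuclideanSpace ℝ (Fin 2)) :
    PlanarEigenmode.vorticity (velocity α ν t) η = vorticity α ν t η := by
  rcases eq_or_ne t 0 with rfl | ht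
  · rw [velocity_time_zero, vorticity]
    simp [PlanarEigenmode.vorticity]
  have h1 := curl_planarLift (velocity α ν) t (embedXY η)
  rw [planarLift_velocity, RadialEddy.curl_lambOseen hν ht, projXY_embedXY, rho_embedXY] at h1
  have h2 := congrArg (fun w : EuclideanSpace ℝ (Fin 3) => w 2) h1
  simp only [eZ, PiLp.smul_apply, PiLp.single_apply, if_true, smul_eq_mul, mul_one] at h2
  rw [← h2, vorticity]

/-- The planar vorticity of the Oseen run as a function of `(t, η)`. [cite: GallayWayne2005, §1 (the Oseen vortices, display preceding Thm. 1.2)] -/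
theorem planarVorticity_velocity_eq (hν : ν ≠ 0) :
    (fun t (η : EuclideanSpace ℝ (Fin 2)) => PlanarEigenmode.vorticity (velocity α ν t) η) =
      vorticity α ν :=
  funext fun t => funext fun η => planarVorticity_velocity hν t η

/-- **The total vorticity of the planar Oseen vortex is `α`** (`νt > 0`).
[cite: GallayWayne2005, §1 (the Oseen vortices, display preceding Thm. 1.2)] -/
theorem integral_vorticity (α : ℝ) (hνt : 0 < ν * t) : ∫ η, vorticity α ν t η = α :=
  RadialEddy.integral_lambOseenVorticity α hνt

/-- The planar Oseen vorticity is positive for `α > 0`, `νt > 0`. [cite: GallayWayne2005, §1 (the Oseen vortices, display preceding Thm. 1.2)] -/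
theorem vorticity_pos (hα : 0 < α) (hν : 0 < ν) (ht : 0 < t) (η : EuclideanSpace ℝ (Fin 2)) :
    0 < vorticity α ν t η := by
  unfold vorticity; positivity

/-- The planar Oseen vorticity is non-negative for `α ≥ 0`, `ν, t > 0`. [cite: GallayWayne2005, §1 (the Oseen vortices, display preceding Thm. 1.2)] -/
theorem vorticity_nonneg (hα : 0 ≤ α) (hν : 0 < ν) (ht : 0 < t) (η : EuclideanSpace ℝ (Fin 2)) :
    0 ≤ vorticity α ν t η := by
  unfold vorticity; positivity

/-- The planar Oseen vorticity as a Gaussian `K e^{−b|η|²}`, `K = α/(4πνt)`, `b = 1/(4νt)`. [folklore] -/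
private theorem vorticity_eq_gaussian (α ν t : ℝ) :
    vorticity α ν t =
      fun η : EuclideanSpace ℝ (Fin 2) => α / (4 * π * ν * t) * exp (-((4 * ν * t)⁻¹ * ‖η‖ ^ 2)) := by
  funext η
  rw [vorticity]
  congr 2
  rw [div_eq_mul_inv, neg_mul, mul_comm]

/-- **"The velocity field given by (BS)": the planar Oseen velocity IS the Biot–Savart velocity of
its vorticity**, `ṽ(t, ·) = K₂ ∗ ω(t, ·)` pointwise, for `ν, t > 0` (the tree's evaluated radial
Biot–Savart law `biotSavart2D_gaussian_eq`). [cite: GallayWayne2005, §1 (the Oseen vortices, display preceding Thm. 1.2)] -/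
theorem velocity_eq_biotSavart2D (hν : 0 < ν) (ht : 0 < t) (η : EuclideanSpace ℝ (Fin 2)) :
    velocity α ν t η = biotSavart2D (vorticity α ν t) η := by
  have h4 : 0 < 4 * ν * t := by positivity
  rw [vorticity_eq_gaussian, biotSavart2D_gaussian_eq (inv_pos.2 h4) _ η]
  by_cases hη : η = 0
  · subst hη; simp
  have hn : ‖η‖ ^ 2 ≠ 0 := by positivity
  rw [velocity_eq_of_ne_zero hν.ne' ht.ne' hη]
  congr 1
  rw [show -((4 * ν * t)⁻¹ * ‖η‖ ^ 2) = -‖η‖ ^ 2 / (4 * ν * t) by ring]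
  field_simp

/-- The slices of the planar Oseen run are smooth (`t > 0`, `ν > 0`). [cite: GallayWayne2005, §1 (the Oseen vortices, display preceding Thm. 1.2)] -/
theorem contDiff_velocity (α : ℝ) (hν : 0 < ν) (ht : 0 < t) : ContDiff ℝ ∞ (velocity α ν t) :=
  (isClassicalNSSolutionOn_Ioi α hν).contDiff_velocity ht

/-! ### §4 The run started at heat age `a > 0` -/

variable {a T : ℝ}

/-- **Time-shifted Oseen vortex**: for every `a`, `σ ↦ ṽ(σ + a)` with pressure `σ ↦ p̃(σ + a)` is a
classical planar Navier–Stokes solution on `(−a, ∞)` (autonomy, `IsClassicalNSSolutionOn.comp_add_right`).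
[cite: GallayWayne2005, §1 (the Oseen vortices, display preceding Thm. 1.2)] -/
theorem isClassicalNSSolutionOn_shift (α : ℝ) (hν : 0 < ν) (a : ℝ) :
    IsClassicalNSSolutionOn (Ioi (-a)) ν 0 (fun σ => velocity α ν (σ + a))
      (fun σ => pressure α ν (σ + a)) := by
  have h := (isClassicalNSSolutionOn_Ioi α hν).comp_add_right a
  have hS : ((· + a) ⁻¹' Ioi (0 : ℝ)) = Ioi (-a) := by
    ext σ; simp only [mem_preimage, mem_Ioi]; constructor <;> intro h <;> linarith
  rw [hS] at h
  exact h

/-- The shifted Oseen run on any time set `S ⊆ (−a, ∞)` of unique differentiability.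
[cite: GallayWayne2005, §1 (the Oseen vortices, display preceding Thm. 1.2)] -/
theorem isClassicalNSSolutionOn_shift_of_subset (α : ℝ) (hν : 0 < ν) {S : Set ℝ}
    (hS : UniqueDiffOn ℝ S) (hSa : S ⊆ Ioi (-a)) :
    IsClassicalNSSolutionOn S ν 0 (fun σ => velocity α ν (σ + a)) (fun σ => pressure α ν (σ + a)) :=
  (isClassicalNSSolutionOn_shift α hν a).mono hSa hS

/-- **The Oseen run started at heat age `a > 0` is a classical planar solution on `[0, ∞)`.**
[cite: GallayWayne2005, §1 (the Oseen vortices, display preceding Thm. 1.2)] -/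
theorem isClassicalNSSolutionOn_shift_Ici (α : ℝ) (hν : 0 < ν) (ha : 0 < a) :
    IsClassicalNSSolutionOn (Ici 0) ν 0 (fun σ => velocity α ν (σ + a))
      (fun σ => pressure α ν (σ + a)) :=
  isClassicalNSSolutionOn_shift_of_subset α hν (uniqueDiffOn_Ici 0) fun σ hσ => by
    simp only [mem_Ici, mem_Ioi] at hσ ⊢; linarith

/-- **The Oseen run started at heat age `a > 0` is a classical planar solution on `[0, T]`** (`T > 0`).
[cite: GallayWayne2005, §1 (the Oseen vortices, display preceding Thm. 1.2)] -/
theorem isClassicalNSSolutionOn_shift_Icc (α : ℝ) (hν : 0 < ν) (ha : 0 < a) (hT : 0 < T) :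
    IsClassicalNSSolutionOn (Icc 0 T) ν 0 (fun σ => velocity α ν (σ + a))
      (fun σ => pressure α ν (σ + a)) :=
  isClassicalNSSolutionOn_shift_of_subset α hν (uniqueDiffOn_Icc hT) fun σ hσ => by
    simp only [mem_Icc, mem_Ioi] at hσ ⊢; linarith

/-- The vorticity of the shifted run at planar time `σ`. [cite: GallayWayne2005, §1 (the Oseen vortices, display preceding Thm. 1.2)] -/
theorem planarVorticity_velocity_shift (hν : ν ≠ 0) (σ : ℝ) (η : EuclideanSpace ℝ (Fin 2)) :
    PlanarEigenmode.vorticity (velocity α ν (σ + a)) η = vorticity α ν (σ + a) η :=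
  planarVorticity_velocity hν _ η

/-- **The initial vorticity of the run started at heat age `a` is the heat Gaussian**
`ω̃(0, η) = (α/4πνa) e^{−|η|²/(4νa)}`. [cite: GallayWayne2005, §1 (the Oseen vortices, display preceding Thm. 1.2)] -/
theorem vorticity_shift_zero (hν : ν ≠ 0) (a : ℝ) (η : EuclideanSpace ℝ (Fin 2)) :
    PlanarEigenmode.vorticity (velocity α ν (0 + a)) η =
      α / (4 * π * ν * a) * exp (-‖η‖ ^ 2 / (4 * ν * a)) := by
  rw [planarVorticity_velocity_shift hν 0 η, vorticity, zero_add]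

/-- The initial vorticity of the run started at heat age `a > 0` has total mass `α` (`ν > 0`).
[cite: GallayWayne2005, §1 (the Oseen vortices, display preceding Thm. 1.2)] -/
theorem integral_vorticity_shift_zero (hν : 0 < ν) (ha : 0 < a) :
    ∫ η, PlanarEigenmode.vorticity (velocity α ν (0 + a)) η = α := by
  simp_rw [planarVorticity_velocity_shift hν.ne' 0]
  rw [zero_add]
  exact integral_vorticity α (mul_pos hν ha)

/-- The initial vorticity of the run started at heat age `a > 0` is non-negative for `α ≥ 0`
(`ν > 0`) — the co-signed hand-over of the planar-vorticity library.
[cite: GallayWayne2005, §1 (the Oseen vortices, display preceding Thm. 1.2)] -/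
theorem vorticity_shift_zero_nonneg (hα : 0 ≤ α) (hν : 0 < ν) (ha : 0 < a)
    (η : EuclideanSpace ℝ (Fin 2)) :
    0 ≤ PlanarEigenmode.vorticity (velocity α ν (0 + a)) η := by
  rw [planarVorticity_velocity_shift hν.ne' 0 η, zero_add]
  exact vorticity_nonneg hα hν ha η

/-- **The shifted run is the Biot–Savart velocity of its vorticity** at every planar time
`σ > −a` (`ν > 0`): `ṽ(σ) = K₂ ∗ ω̃(σ)`. [cite: GallayWayne2005, §1 (the Oseen vortices, display preceding Thm. 1.2)] -/
theorem velocity_shift_eq_biotSavart2D (hν : 0 < ν) {σ : ℝ} (hσ : 0 < σ + a)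
    (η : EuclideanSpace ℝ (Fin 2)) :
    velocity α ν (σ + a) η = biotSavart2D (PlanarEigenmode.vorticity (velocity α ν (σ + a))) η := by
  have h : PlanarEigenmode.vorticity (velocity α ν (σ + a)) = vorticity α ν (σ + a) :=
    funext (planarVorticity_velocity_shift hν.ne' σ)
  rw [h]
  exact velocity_eq_biotSavart2D hν hσ η

/-- On `[0, T]` (`a > 0`) the shifted run is the Biot–Savart velocity of its vorticity at every time.
[cite: GallayWayne2005, §1 (the Oseen vortices, display preceding Thm. 1.2)] -/
theorem velocity_shift_eq_biotSavart2D_Icc (hν : 0 < ν) (ha : 0 < a) (T : ℝ) :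
    ∀ σ ∈ Icc 0 T, ∀ η : EuclideanSpace ℝ (Fin 2),
      velocity α ν (σ + a) η = biotSavart2D (PlanarEigenmode.vorticity (velocity α ν (σ + a))) η :=
  fun σ hσ η => velocity_shift_eq_biotSavart2D hν (by linarith [hσ.1]) η

/-- **The vorticity of the Oseen run started at heat age `a > 0` is uniformly Schwartz on every
compact slab `[0, T] × ℝ²`** (`T > 0`, `ν > 0`): the tree's `HasUniformRapidDecayOn (Icc 0 T)` for
`(σ, η) ↦ (α/4πν(σ+a)) e^{−|η|²/(4ν(σ+a))}` — §3′ with `c(σ) = α/(4πν(σ+a))`, `r(σ) = (4ν(σ+a))⁻¹ ≥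
(4ν(T+a))⁻¹`. [cite: GallayWayne2005, §1 (the Oseen vortices, display preceding Thm. 1.2)] -/
theorem hasUniformRapidDecayOn_vorticity_shift (hν : 0 < ν) (ha : 0 < a) (hT : 0 < T) (α : ℝ) :
    HasUniformRapidDecayOn (Icc 0 T)
      (fun σ (η : EuclideanSpace ℝ (Fin 2)) => vorticity α ν (σ + a) η) := by
  have heq : (fun σ (η : EuclideanSpace ℝ (Fin 2)) => vorticity α ν (σ + a) η) =
      fun σ (η : EuclideanSpace ℝ (Fin 2)) =>
        α / (4 * π * ν * (σ + a)) * exp (-((4 * ν * (σ + a))⁻¹ * ‖η‖ ^ 2)) :=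
    funext fun σ => vorticity_eq_gaussian α ν (σ + a)
  rw [heq]
  have hden : ∀ σ ∈ Icc (0 : ℝ) T, 4 * ν * (σ + a) ≠ 0 := fun σ hσ => by
    have := hσ.1; positivity
  have hden' : ∀ σ ∈ Icc (0 : ℝ) T, 4 * π * ν * (σ + a) ≠ 0 := fun σ hσ => by
    have := hσ.1; positivity
  refine hasUniformRapidDecayOn_mul_exp_neg_mul_norm_sq isCompact_Icc (uniqueDiffOn_Icc hT)
    (contDiffOn_const.div (by fun_prop) hden') ((by fun_prop : ContDiffOn ℝ ∞
      (fun σ : ℝ => 4 * ν * (σ + a)) (Icc 0 T)).inv hden) (r₀ := (4 * ν * (T + a))⁻¹)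
    (by positivity) fun σ hσ => ?_
  have h0 := hσ.1
  exact inv_anti₀ (by positivity) (by nlinarith [hσ.2])

/-- The same decay for the vorticity read as `∂₁ṽ₂ − ∂₂ṽ₁` of the run (the form in which the
planar-vorticity library takes it). [cite: GallayWayne2005, §1 (the Oseen vortices, display preceding Thm. 1.2)] -/
theorem hasUniformRapidDecayOn_planarVorticity_shift (hν : 0 < ν) (ha : 0 < a) (hT : 0 < T) (α : ℝ) :
    HasUniformRapidDecayOn (Icc 0 T)
      (fun σ (η : EuclideanSpace ℝ (Fin 2)) => PlanarEigenmode.vorticity (velocity α ν (σ + a)) η) := by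
  have heq : (fun σ (η : EuclideanSpace ℝ (Fin 2)) => PlanarEigenmode.vorticity (velocity α ν (σ + a)) η) =
      fun σ (η : EuclideanSpace ℝ (Fin 2)) => vorticity α ν (σ + a) η :=
    funext fun σ => funext fun η => planarVorticity_velocity_shift hν.ne' σ η
  rw [heq]
  exact hasUniformRapidDecayOn_vorticity_shift hν ha hT α

end PlanarLambOseen

end Literature.Analysis.FluidPDE
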